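import Summits.Ventures.LatticeQCDFlow.Exactness.Phi4FlowSquareIntegrableCeiling
import HarnessLib

/-!
# The best flow for REWEIGHTING an observable is not the target: `inf_flows σ²_RW(g) = (E_π|g|)² ≤ Var_π(g)`,
# a floor the exact chain of NO flow can cross (`σ²_chain(g) ≥ Var_π(g)` for every flow)

HONEST FRAMING: exact (Metropolis-corrected) sampling algorithms for lattice gauge theory;
figures of merit are autocorrelation/cost numbers at stated couplings and volumes; no
continuum-physics claim.  (SCALAR calibration rung S0-A: not a gauge result.)

Venture `LatticeQCDFlow` (cell pub-lqcd), topic `Exactness`; FANOUT row 2 (`s0-phi4`, FLOW arm).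
NEW WORK of the cell (one AM–GM inequality with a free scale, integrated and optimised; one explicit
family of flows; the tree's `τ_int ≥ ½` for the positive operator `imhOp`); nothing is cited as a
fact; no definition.  Printed counterparts NAMED ONLY: T. Hesterberg, *Advances in importance
sampling*, PhD thesis, Stanford 1988, and A. B. Owen, *Monte Carlo theory, methods and examples*
(2013) §9.2 — the asymptotically optimal proposal of SELF-NORMALISED importance sampling for `E_π f`
is `q⋆ ∝ |f − E_π f|·π`, with limiting `N·variance` `(E_π|f − E_π f|)²`.

Setting (general measurable space `(X, μ)`): target weight `w > 0` (`Z = ∫ w`, `π = w/Z`), a flow =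
a positive measurable model density `q̃` with `∫ q̃ = 1`, importance weight `b = w/q̃`; for a centred
observable `g` the two per-model-draw figures of merit of this generation's files
(`FlowSamplerVsReweighting.lean`, `Phi4FlowReweightingCLT.lean`):
`σ²_RW(g) = Z⁻² ∫ g² b w dμ` (self-normalised reweighting of the independent draws) and
`σ²_chain(g) = 2 τ_int(g) · Var_π(g)` (ergodic average of the exact chain `imhOp μ w q̃`).
GEN-24 #1 proved `σ²_RW ≤ σ²_chain` flow by flow; #2 exhibited a two-state flow with
`σ²_RW < Var_π(g)`.  This file is the general law behind #2, OPTIMISED OVER THE FLOW: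

* for EVERY flow, `(∫ |g| w)² ≤ ∫ g² b w` (Cauchy–Schwarz), i.e. `σ²_RW(g) ≥ (E_π|g|)²`;
* the floor is the infimum: for every `ε > 0` the regularised observable-targeted flow
  `q̃_δ = (|g| + δ) w/(∫|g|w + δZ)` has `∫ g² b w ≤ (∫|g|w)² + ε`;
* `(∫|g|w)² ≤ Z ∫ g² w`, i.e. `(E_π|g|)² ≤ E_π[g²] = Var_π(g)` — the infimum over flows of the
  reweighting variance is at most the variance of I.I.D. SAMPLING FROM THE TARGET (the reweighting
  variance of the 'perfect' flow `q̃ = π`, for which `b ≡ Z`);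
* whereas for EVERY flow and every square-integrable centred `g` with a summable series,
  `Var_π(g) ≤ σ²_chain(g)` (`τ_int ≥ ½`: the exact flow sampler is a positive operator — the tree's
  sticking floor `imhOp_tauInt_ge_half_add_rejection_of_sq`).

Reading for S0-A (no numerics implied): when flow draws are REWEIGHTED, matching the target is not
the right training objective for a given observable — an observable-targeted flow can push the
reweighting error bar below the i.i.d.-from-the-target value `√(Var/N)`, a floor the accept/reject
chain of no flow can cross (price, GEN-24 #4/#5: poor Kish fraction, possibly a non-summable chain).

## What is proved

* `two_mul_mul_le_sq_div_add` — `2 a t ≤ t² a²/q + q` (`q > 0`, all real `a, t`);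
  `integrable_abs_mul_of_sq_mul` — `g² w, w ∈ L¹ ⇒ |g| w ∈ L¹`;
* **`integrable_abs_mul_weight_of_reweightMoment`** — `g² b w ∈ L¹`, `q̃ ∈ L¹ ⇒ g w ∈ L¹`;
* **`sq_integral_abs_mul_le_reweightMoment_mul`** — `(∫|g|w)² ≤ (∫ g² b w)(∫ q̃)` for every
  positive `q̃ ∈ L¹` (no normalisation needed); **`sq_integral_abs_mul_le_reweightMoment`** — the
  flow case `∫ q̃ = 1`: `(∫|g|w)² ≤ ∫ g² b w`;
* **`exists_flow_reweightMoment_le`** — `w > 0` measurable integrable with `Z > 0`, `g` measurable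
  with `|g| w ∈ L¹`: for every `ε > 0` a positive measurable flow `q̃` with `∫ q̃ = 1`,
  `g² b w ∈ L¹` and `∫ g² b w ≤ (∫|g|w)² + ε`;
* **`sq_integral_abs_mul_le_Z_mul`** — `(∫|g|w)² ≤ Z · ∫ g² w`;
* **`imhOp_targetVar_le_chainVar_of_sq`** — for EVERY flow `q̃`, every measurable `g ∈ L²(w)` with
  summable series: `(∫ g² w)/Z ≤ 2 τ_int(g) · (∫ g² w)/Z`;
  **`imhOp_sq_meanAbs_le_chainVar_of_sq`** — hence `(∫|g|w)²/Z² ≤ 2 τ_int(g) · (∫ g² w)/Z`: the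
  infimum over flows of `σ²_RW(g)` is below the chain's `σ²` for every flow;
* lattice φ⁴ (`λ > 0`, real `J`, `f ∈ PolyObs`, `g = f − ⟨f⟩`):
  **`phi4_sq_meanAbsDev_le_reweightMoment`** (every flow with `g² b e^{−S} ∈ L¹`),
  **`phi4_exists_flow_reweightMoment_le`**, **`phi4_sq_meanAbsDev_le_var`**
  (`(∫|f − ⟨f⟩| e^{−S})² ≤ Z ∫ (f − ⟨f⟩)² e^{−S}`), **`phi4Flow_targetVar_le_chainVar_poly`**
  (every flow, summable series ⇒ `Var(f) ≤ σ²_chain(f)`).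

NOT CLAIMED: strictness of `(E_π|g|)² ≤ Var_π(g)` (strict unless `|g|` is `π`-a.s. constant — not
typed); that `q̃_δ` is trainable or useful; anything at finite `N`; any value; HMC / local arms.
-/

namespace Summit.Ventures.LatticeQCDFlow.Exactness

open Real MeasureTheory Filter Set
open Summit.Ventures.LatticeQCDFlow.Scoring

section General

variable {X : Type*} [MeasurableSpace X] {μ : Measure X} {w q : X → ℝ}

/-! ## §0 Two elementary lemmas -/

/-- AM–GM with a free scale: `2 a t ≤ t² · a²/q + q` for `q > 0` and all real `a, t`
(`(t a − q)² ≥ 0` divided by `q`). -/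
theorem two_mul_mul_le_sq_div_add {a q : ℝ} (t : ℝ) (hq : 0 < q) :
    2 * a * t ≤ t ^ 2 * (a ^ 2 / q) + q := by
  have h : t ^ 2 * (a ^ 2 / q) + q - 2 * a * t = (t * a - q) ^ 2 / q := by field_simp; ring
  linarith [div_nonneg (sq_nonneg (t * a - q)) hq.le]

/-- `g² w ∈ L¹` and `w ∈ L¹` (`w ≥ 0`) give `|g| w ∈ L¹` (`2|g| ≤ g² + 1`). -/
theorem integrable_abs_mul_of_sq_mul (hw0 : ∀ x, 0 ≤ w x) (hwm : Measurable w)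
    (hwi : Integrable w μ) {g : X → ℝ} (hgm : Measurable g)
    (hg2 : Integrable (fun x => g x ^ 2 * w x) μ) :
    Integrable (fun x => |g x| * w x) μ := by
  refine Integrable.mono' (hg2.add hwi)
    (((continuous_abs.measurable.comp hgm).mul hwm).aestronglyMeasurable)
    (Eventually.of_forall fun x => ?_)
  change ‖|g x| * w x‖ ≤ g x ^ 2 * w x + w x
  rw [Real.norm_eq_abs, abs_mul, abs_abs, abs_of_nonneg (hw0 x)]
  have h : 2 * |g x| ≤ g x ^ 2 + 1 := by nlinarith [sq_nonneg (|g x| - 1), sq_abs (g x)]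
  nlinarith [hw0 x, abs_nonneg (g x)]

/-! ## §1 The Cauchy–Schwarz floor of the reweighting moment over all flows -/

/-- **`σ²_RW(g) < ∞ ⇒ g w ∈ L¹`**: `g² b w ∈ L¹` and `q̃ ∈ L¹` (`q̃ > 0`) give `|g| w ∈ L¹`
(`2|g w| ≤ g² w²/q̃ + q̃`). -/
theorem integrable_abs_mul_weight_of_reweightMoment (hq0 : ∀ x, 0 < q x)
    (hqi : Integrable q μ) (hwm : Measurable w) {g : X → ℝ} (hgm : Measurable g)
    (hint : Integrable (fun x => g x ^ 2 * (w x / q x * w x)) μ) :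
    Integrable (fun x => |g x| * w x) μ := by
  refine Integrable.mono' (hint.add hqi)
    (((continuous_abs.measurable.comp hgm).mul hwm).aestronglyMeasurable)
    (Eventually.of_forall fun x => ?_)
  change ‖|g x| * w x‖ ≤ g x ^ 2 * (w x / q x * w x) + q x
  rw [Real.norm_eq_abs, abs_mul, abs_abs]
  have h := two_mul_mul_le_sq_div_add (a := |g x| * |w x|) 1 (hq0 x)
  have e : (|g x| * |w x|) ^ 2 / q x = g x ^ 2 * (w x / q x * w x) := by
    rw [mul_pow, sq_abs, sq_abs]; ring
  rw [one_pow, one_mul, e, mul_one] at h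
  nlinarith [h, abs_nonneg (g x), abs_nonneg (w x), mul_nonneg (abs_nonneg (g x)) (abs_nonneg (w x))]

/-- **THE CAUCHY–SCHWARZ FLOOR, unnormalised form**: `w ≥ 0`, `q̃ > 0` integrable, `g² b w ∈ L¹`:
`(∫ |g| w)² ≤ (∫ g² b w) · (∫ q̃)` (`b = w/q̃`). -/
theorem sq_integral_abs_mul_le_reweightMoment_mul (hw0 : ∀ x, 0 ≤ w x) (hwm : Measurable w)
    (hq0 : ∀ x, 0 < q x) (hqi : Integrable q μ) {g : X → ℝ} (hgm : Measurable g)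
    (hint : Integrable (fun x => g x ^ 2 * (w x / q x * w x)) μ) :
    (∫ x, |g x| * w x ∂μ) ^ 2 ≤ (∫ x, g x ^ 2 * (w x / q x * w x) ∂μ) * ∫ x, q x ∂μ := by
  set A := ∫ x, g x ^ 2 * (w x / q x * w x) ∂μ with hA
  set Q := ∫ x, q x ∂μ with hQ
  set L := ∫ x, |g x| * w x ∂μ with hL
  have hgw := integrable_abs_mul_weight_of_reweightMoment hq0 hqi hwm hgm hint
  -- for every real `t`: `2 L t ≤ t² A + Q`
  have key : ∀ t : ℝ, 2 * L * t ≤ t ^ 2 * A + Q := by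
    intro t
    have hpt : ∀ x, 2 * (|g x| * w x) * t ≤ t ^ 2 * (g x ^ 2 * (w x / q x * w x)) + q x := by
      intro x
      have h := two_mul_mul_le_sq_div_add (a := |g x| * w x) t (hq0 x)
      have e : (|g x| * w x) ^ 2 / q x = g x ^ 2 * (w x / q x * w x) := by
        rw [mul_pow, sq_abs]; ring
      rw [e] at h
      exact h
    have h1 : ∫ x, 2 * (|g x| * w x) * t ∂μ ≤ ∫ x, (t ^ 2 * (g x ^ 2 * (w x / q x * w x)) + q x) ∂μ :=
      integral_mono ((hgw.const_mul 2).mul_const t) ((hint.const_mul _).add hqi) hpt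
    rw [integral_mul_const, integral_const_mul, integral_add (hint.const_mul _) hqi,
      integral_const_mul] at h1
    exact h1
  have hA0 : 0 ≤ A := integral_nonneg fun x => mul_nonneg (sq_nonneg _)
    (mul_nonneg (div_nonneg (hw0 x) (hq0 x).le) (hw0 x))
  have hQ0 : 0 ≤ Q := integral_nonneg fun x => (hq0 x).le
  have hL0 : 0 ≤ L := integral_nonneg fun x => mul_nonneg (abs_nonneg _) (hw0 x)
  rcases hL0.eq_or_lt with hLz | hLpos
  · rw [← hLz]
    simpa using mul_nonneg hA0 hQ0
  rcases hA0.eq_or_lt with hAz | hApos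
  · -- `A = 0` is impossible with `L > 0`: `t = (Q + 1)/L` gives `2(Q+1) ≤ Q`
    have h := key ((Q + 1) / L)
    rw [← hAz, mul_zero, zero_add] at h
    have e : 2 * L * ((Q + 1) / L) = 2 * (Q + 1) := by
      field_simp
    rw [e] at h
    linarith
  · have h := key (L / A)
    have e1 : 2 * L * (L / A) = 2 * (L ^ 2 / A) := by field_simp
    have e2 : (L / A) ^ 2 * A = L ^ 2 / A := by field_simp
    rw [e1, e2] at h
    have h3 : L ^ 2 / A ≤ Q := by linarith
    rw [div_le_iff₀ hApos] at h3
    linarith [h3, mul_comm Q A]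

/-- **THE CAUCHY–SCHWARZ FLOOR OVER ALL FLOWS**: for a flow (`∫ q̃ = 1`), `(∫ |g| w)² ≤ ∫ g² b w`:
in variance units `σ²_RW(g) = Z⁻² ∫ g² b w ≥ (Z⁻¹∫|g|w)² = (E_π|g|)²`, whatever the flow. -/
theorem sq_integral_abs_mul_le_reweightMoment (hw0 : ∀ x, 0 ≤ w x) (hwm : Measurable w)
    (hq0 : ∀ x, 0 < q x) (hqi : Integrable q μ) (hq1 : ∫ x, q x ∂μ = 1) {g : X → ℝ}
    (hgm : Measurable g) (hint : Integrable (fun x => g x ^ 2 * (w x / q x * w x)) μ) :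
    (∫ x, |g x| * w x ∂μ) ^ 2 ≤ ∫ x, g x ^ 2 * (w x / q x * w x) ∂μ := by
  have h := sq_integral_abs_mul_le_reweightMoment_mul hw0 hwm hq0 hqi hgm hint
  rw [hq1, mul_one] at h
  exact h

/-! ## §2 The floor is the infimum: regularised observable-targeted flows -/

/-- **THE INFIMUM OVER FLOWS IS `(∫|g|w)²`**: `w > 0` measurable integrable with `Z = ∫ w > 0`, `g`
measurable with `|g| w ∈ L¹`, `L = ∫ |g| w`.  For every `ε > 0` the flow
`q̃(x) = (|g x| + δ) w(x)/(L + δZ)` (`δ = ε/(LZ + 1)`) is positive, measurable, `∫ q̃ = 1`, and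
`∫ g² b w = (L + δZ) ∫ g² w/(|g| + δ) ≤ (L + δZ) L ≤ L² + ε`. -/
theorem exists_flow_reweightMoment_le (hw0 : ∀ x, 0 < w x) (hwm : Measurable w)
    (hwi : Integrable w μ) (hZ : 0 < ∫ x, w x ∂μ) {g : X → ℝ} (hgm : Measurable g)
    (hgw : Integrable (fun x => |g x| * w x) μ) {ε : ℝ} (hε : 0 < ε) :
    ∃ q : X → ℝ, (∀ x, 0 < q x) ∧ Measurable q ∧ Integrable q μ ∧ ∫ x, q x ∂μ = 1 ∧
      Integrable (fun x => g x ^ 2 * (w x / q x * w x)) μ ∧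
      ∫ x, g x ^ 2 * (w x / q x * w x) ∂μ ≤ (∫ x, |g x| * w x ∂μ) ^ 2 + ε := by
  set L := ∫ x, |g x| * w x ∂μ with hL
  set Z := ∫ x, w x ∂μ with hZdef
  have hL0 : 0 ≤ L := integral_nonneg fun x => mul_nonneg (abs_nonneg _) (hw0 x).le
  set δ : ℝ := ε / (L * Z + 1) with hδ
  have hLZ : 0 < L * Z + 1 := by positivity
  have hδ0 : 0 < δ := div_pos hε hLZ
  set D : ℝ := L + δ * Z with hD
  have hD0 : 0 < D := by positivity
  have hqm : Measurable fun x => (|g x| + δ) * w x / D :=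
    (((continuous_abs.measurable.comp hgm).add_const δ).mul hwm).div_const D
  have hq0 : ∀ x, 0 < (|g x| + δ) * w x / D := fun x =>
    div_pos (mul_pos (by positivity) (hw0 x)) hD0
  have hqi : Integrable (fun x => (|g x| + δ) * w x / D) μ := by
    have h : Integrable (fun x => (|g x| * w x + δ * w x) / D) μ := (hgw.add (hwi.const_mul δ)).div_const D
    exact h.congr (Eventually.of_forall fun x => by ring)
  refine ⟨fun x => (|g x| + δ) * w x / D, hq0, hqm, hqi, ?_, ?_⟩
  · -- normalisation
    have e : ∫ x, (|g x| + δ) * w x / D ∂μ = (∫ x, (|g x| * w x + δ * w x) ∂μ) / D := by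
      rw [← integral_div]
      exact integral_congr_ae (Eventually.of_forall fun x => by ring)
    rw [e, integral_add hgw (hwi.const_mul δ), integral_const_mul, ← hL, ← hZdef, ← hD]
    exact div_self hD0.ne'
  · -- the moment: pointwise `g² b w = D g² w/(|g| + δ) ≤ D |g| w`
    have hid : ∀ x, g x ^ 2 * (w x / ((|g x| + δ) * w x / D) * w x)
        = D * (g x ^ 2 / (|g x| + δ)) * w x := by
      intro x
      have hw := (hw0 x).ne'
      have hgd : |g x| + δ ≠ 0 := by positivity
      field_simp
    have hpt : ∀ x, D * (g x ^ 2 / (|g x| + δ)) * w x ≤ D * |g x| * w x := by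
      intro x
      have hgd : 0 < |g x| + δ := by positivity
      have h1 : g x ^ 2 / (|g x| + δ) ≤ |g x| := by
        rw [div_le_iff₀ hgd]
        nlinarith [sq_abs (g x), abs_nonneg (g x), hδ0]
      have := mul_le_mul_of_nonneg_left h1 hD0.le
      exact mul_le_mul_of_nonneg_right this (hw0 x).le
    have hm : Measurable fun x => D * (g x ^ 2 / (|g x| + δ)) * w x :=
      (((hgm.pow_const 2).div ((continuous_abs.measurable.comp hgm).add_const δ)).const_mul D).mul hwm
    have h0 : ∀ x, 0 ≤ D * (g x ^ 2 / (|g x| + δ)) * w x := fun x =>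
      mul_nonneg (mul_nonneg hD0.le (div_nonneg (sq_nonneg _) (by positivity))) (hw0 x).le
    have hdom : Integrable (fun x => D * |g x| * w x) μ :=
      (hgw.const_mul D).congr (Eventually.of_forall fun x => by ring)
    have hint' : Integrable (fun x => D * (g x ^ 2 / (|g x| + δ)) * w x) μ :=
      Integrable.mono' hdom hm.aestronglyMeasurable (Eventually.of_forall fun x => by
        rw [Real.norm_eq_abs, abs_of_nonneg (h0 x)]; exact hpt x)
    have hfun : (fun x => g x ^ 2 * (w x / ((|g x| + δ) * w x / D) * w x))
        = fun x => D * (g x ^ 2 / (|g x| + δ)) * w x := funext hid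
    refine ⟨by rw [hfun]; exact hint', ?_⟩
    rw [hfun]
    calc ∫ x, D * (g x ^ 2 / (|g x| + δ)) * w x ∂μ
        ≤ ∫ x, D * |g x| * w x ∂μ := integral_mono hint' hdom hpt
      _ = D * L := by
          rw [hL, ← integral_const_mul]
          exact integral_congr_ae (Eventually.of_forall fun x => by ring)
      _ = L ^ 2 + ε * (L * Z / (L * Z + 1)) := by
          rw [hD, hδ]; field_simp
      _ ≤ L ^ 2 + ε := by
          have h1 : L * Z / (L * Z + 1) ≤ 1 := by
            rw [div_le_one hLZ]; linarith
          nlinarith [h1, hε]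

/-! ## §3 The infimum is below the i.i.d.-from-the-target variance -/

/-- **`(∫ |g| w)² ≤ Z · ∫ g² w`** (`(E_π|g|)² ≤ E_π[g²]`): the Cauchy–Schwarz floor of §1 for the
'perfect' flow `q̃ = π` (for which `b ≡ Z` and `σ²_RW(g) = Var_π(g)`, the i.i.d. value). -/
theorem sq_integral_abs_mul_le_Z_mul (hw0 : ∀ x, 0 < w x) (hwm : Measurable w)
    (hwi : Integrable w μ) {g : X → ℝ} (hgm : Measurable g)
    (hg2 : Integrable (fun x => g x ^ 2 * w x) μ) :
    (∫ x, |g x| * w x ∂μ) ^ 2 ≤ (∫ x, w x ∂μ) * ∫ x, g x ^ 2 * w x ∂μ := by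
  have e : (fun x => g x ^ 2 * (w x / w x * w x)) = fun x => g x ^ 2 * w x :=
    funext fun x => by rw [div_self (hw0 x).ne', one_mul]
  have h := sq_integral_abs_mul_le_reweightMoment_mul (q := w) (fun x => (hw0 x).le) hwm hw0 hwi
    hgm (by rw [e]; exact hg2)
  rw [e] at h
  linarith [mul_comm (∫ x, g x ^ 2 * w x ∂μ) (∫ x, w x ∂μ)]

/-! ## §4 The chain side: `Var_π(g) ≤ σ²_chain(g)` for EVERY flow -/

variable [SFinite μ]

/-- **FOR EVERY FLOW, `Var_π(g) ≤ σ²_chain(g)`**: `w, q̃ > 0` measurable integrable, `∫ q̃ = 1`,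
`g ∈ L²(w)` measurable with a summable autocorrelation series along `imhOp μ w q̃`; then
`(∫ g² w)/Z ≤ 2 τ_int(g) · (∫ g² w)/Z` — `τ_int ≥ ½` by the tree's sticking floor
(`imhOp_tauInt_ge_half_add_rejection_of_sq`: the exact flow sampler is a positive operator). -/
theorem imhOp_targetVar_le_chainVar_of_sq (hw0 : ∀ t, 0 < w t) (hwm : Measurable w)
    (hwi : Integrable w μ) (hq0 : ∀ t, 0 < q t) (hqm : Measurable q) (hqi : Integrable q μ)
    (hq1 : ∫ z, q z ∂μ = 1) {g : X → ℝ} (hgm : Measurable g)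
    (hg2 : Integrable (fun t => g t ^ 2 * w t) μ)
    (hs : Summable fun n => (∫ x, g x * ((imhOp μ w q)^[n + 1] g) x * w x ∂μ)
      / ∫ x, g x ^ 2 * w x ∂μ) :
    (∫ x, g x ^ 2 * w x ∂μ) / (∫ z, w z ∂μ)
      ≤ 2 * tauInt (fun n => (∫ x, g x * ((imhOp μ w q)^[n] g) x * w x ∂μ)
            / ∫ x, g x ^ 2 * w x ∂μ) * ((∫ x, g x ^ 2 * w x ∂μ) / ∫ z, w z ∂μ) := by
  obtain ⟨h1, h2⟩ := imhOp_tauInt_ge_half_add_rejection_of_sq hw0 hwm hwi hq0 hqm hqi hq1 hgm hg2 hs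
  obtain ⟨hr0, -, -⟩ := rejection_bounds (μ := μ) hw0 hwm hq0 hqm hqi hq1
  have hZ : 0 < ∫ z, w z ∂μ := integral_pos_of_pos hw0 hwi hq1
  have hA0 : 0 ≤ ∫ x, g x ^ 2 * w x ∂μ :=
    integral_nonneg fun x => mul_nonneg (sq_nonneg _) (hw0 x).le
  have hnum : 0 ≤ ∫ x, g x ^ 2 * w x * (∫ t', (1 - imhAcceptQ w q x t') * q t' ∂μ) ∂μ :=
    integral_nonneg fun x => mul_nonneg (mul_nonneg (sq_nonneg _) (hw0 x).le) (hr0 x)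
  have hτ : 1 / 2 ≤ tauInt (fun n => (∫ x, g x * ((imhOp μ w q)^[n] g) x * w x ∂μ)
      / ∫ x, g x ^ 2 * w x ∂μ) := by
    have := div_nonneg hnum hA0
    linarith [h1, h2]
  have hV0 : 0 ≤ (∫ x, g x ^ 2 * w x ∂μ) / ∫ z, w z ∂μ := div_nonneg hA0 hZ.le
  nlinarith [hτ, hV0]

/-- **THE INFIMUM OVER FLOWS OF `σ²_RW` IS BELOW `σ²_chain` OF EVERY FLOW**: under the hypotheses of
`imhOp_targetVar_le_chainVar_of_sq`, `(∫|g|w)²/Z² ≤ 2 τ_int(g) · (∫ g² w)/Z`. -/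
theorem imhOp_sq_meanAbs_le_chainVar_of_sq (hw0 : ∀ t, 0 < w t) (hwm : Measurable w)
    (hwi : Integrable w μ) (hq0 : ∀ t, 0 < q t) (hqm : Measurable q) (hqi : Integrable q μ)
    (hq1 : ∫ z, q z ∂μ = 1) {g : X → ℝ} (hgm : Measurable g)
    (hg2 : Integrable (fun t => g t ^ 2 * w t) μ)
    (hs : Summable fun n => (∫ x, g x * ((imhOp μ w q)^[n + 1] g) x * w x ∂μ)
      / ∫ x, g x ^ 2 * w x ∂μ) :
    (∫ x, |g x| * w x ∂μ) ^ 2 / (∫ z, w z ∂μ) ^ 2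
      ≤ 2 * tauInt (fun n => (∫ x, g x * ((imhOp μ w q)^[n] g) x * w x ∂μ)
            / ∫ x, g x ^ 2 * w x ∂μ) * ((∫ x, g x ^ 2 * w x ∂μ) / ∫ z, w z ∂μ) := by
  have hZ : 0 < ∫ z, w z ∂μ := integral_pos_of_pos hw0 hwi hq1
  have hcs := sq_integral_abs_mul_le_Z_mul hw0 hwm hwi hgm hg2
  have hch := imhOp_targetVar_le_chainVar_of_sq hw0 hwm hwi hq0 hqm hqi hq1 hgm hg2 hs
  have h1 : (∫ x, |g x| * w x ∂μ) ^ 2 / (∫ z, w z ∂μ) ^ 2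
      ≤ (∫ x, g x ^ 2 * w x ∂μ) / ∫ z, w z ∂μ := by
    rw [div_le_iff₀ (pow_pos hZ 2)]
    have e : (∫ x, g x ^ 2 * w x ∂μ) / (∫ z, w z ∂μ) * (∫ z, w z ∂μ) ^ 2
        = (∫ z, w z ∂μ) * ∫ x, g x ^ 2 * w x ∂μ := by
      field_simp
    rw [e]
    exact hcs
  exact h1.trans hch

end General

/-! ## §5 Lattice φ⁴ corollaries (`λ > 0`, real `J`, ANY flow) -/

section Lattice

variable {n : ℕ}

/-- **For every flow and every `f ∈ PolyObs`** with `(f − ⟨f⟩)² b e^{−S} ∈ L¹`: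
`(∫ |f − ⟨f⟩| e^{−S})² ≤ ∫ (f − ⟨f⟩)² b e^{−S}` — `σ²_RW(f) ≥ (E|f − ⟨f⟩|)²` whatever the network. -/
theorem phi4_sq_meanAbsDev_le_reweightMoment {lam : ℝ} (hlam : 0 < lam)
    (J : Fin (n + 1) → Fin (n + 1) → ℝ) {q : (Fin (n + 1) → ℝ) → ℝ} (hq0 : ∀ φ, 0 < q φ)
    (hqi : Integrable q) (hq1 : ∫ φ, q φ = 1)
    {f : (Fin (n + 1) → ℝ) → ℝ} (hf : PolyObs f)
    (hint : Integrable (fun φ => (f φ - gibbsExpect J lam f) ^ 2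
      * (gibbsWeight J lam φ / q φ * gibbsWeight J lam φ))) :
    (∫ φ, |f φ - gibbsExpect J lam f| * gibbsWeight J lam φ) ^ 2
      ≤ ∫ φ, (f φ - gibbsExpect J lam f) ^ 2 * (gibbsWeight J lam φ / q φ * gibbsWeight J lam φ) := by
  obtain ⟨hgm, -⟩ := polyObs_sq_integrable hlam J (polyObs_sub_const hf (gibbsExpect J lam f))
  exact sq_integral_abs_mul_le_reweightMoment (μ := volume) (fun φ => (gibbsWeight_pos J lam φ).le)
    (continuous_gibbsWeight J lam).measurable hq0 hqi hq1 hgm hint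

/-- **The infimum over flows is `(∫ |f − ⟨f⟩| e^{−S})²`**: for every `f ∈ PolyObs` and every `ε > 0`
there is a positive measurable flow `q̃` on `ℝ^Λ` with `∫ q̃ = 1`, finite reweighting moment and
`∫ (f − ⟨f⟩)² b e^{−S} ≤ (∫ |f − ⟨f⟩| e^{−S})² + ε`. -/
theorem phi4_exists_flow_reweightMoment_le {lam : ℝ} (hlam : 0 < lam)
    (J : Fin (n + 1) → Fin (n + 1) → ℝ) {f : (Fin (n + 1) → ℝ) → ℝ} (hf : PolyObs f)
    {ε : ℝ} (hε : 0 < ε) :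
    ∃ q : (Fin (n + 1) → ℝ) → ℝ, (∀ φ, 0 < q φ) ∧ Measurable q ∧ Integrable q ∧ ∫ φ, q φ = 1 ∧
      Integrable (fun φ => (f φ - gibbsExpect J lam f) ^ 2
        * (gibbsWeight J lam φ / q φ * gibbsWeight J lam φ)) ∧
      ∫ φ, (f φ - gibbsExpect J lam f) ^ 2 * (gibbsWeight J lam φ / q φ * gibbsWeight J lam φ)
        ≤ (∫ φ, |f φ - gibbsExpect J lam f| * gibbsWeight J lam φ) ^ 2 + ε := by
  obtain ⟨hgm, hg2⟩ := polyObs_sq_integrable hlam J (polyObs_sub_const hf (gibbsExpect J lam f))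
  have hw0 := fun φ => gibbsWeight_pos J lam φ
  have hwm := (continuous_gibbsWeight J lam).measurable
  have hwi := integrable_gibbsWeight hlam J
  have hgw := integrable_abs_mul_of_sq_mul (μ := volume) (fun φ => (hw0 φ).le) hwm hwi hgm hg2
  exact exists_flow_reweightMoment_le (μ := volume) hw0 hwm hwi (gibbsZ_pos hlam J) hgm hgw hε

/-- **`(∫ |f − ⟨f⟩| e^{−S})² ≤ Z · ∫ (f − ⟨f⟩)² e^{−S}`** for every `f ∈ PolyObs`: the infimum over
flows of the reweighting variance `Z⁻²·inf ∫(f−⟨f⟩)² b e^{−S}` is at most `Var(f)`, the variance of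
i.i.d. sampling from the Gibbs law itself. -/
theorem phi4_sq_meanAbsDev_le_var {lam : ℝ} (hlam : 0 < lam)
    (J : Fin (n + 1) → Fin (n + 1) → ℝ) {f : (Fin (n + 1) → ℝ) → ℝ} (hf : PolyObs f) :
    (∫ φ, |f φ - gibbsExpect J lam f| * gibbsWeight J lam φ) ^ 2
      ≤ gibbsZ J lam * ∫ φ, (f φ - gibbsExpect J lam f) ^ 2 * gibbsWeight J lam φ := by
  obtain ⟨hgm, hg2⟩ := polyObs_sq_integrable hlam J (polyObs_sub_const hf (gibbsExpect J lam f))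
  exact sq_integral_abs_mul_le_Z_mul (μ := volume) (fun φ => gibbsWeight_pos J lam φ)
    (continuous_gibbsWeight J lam).measurable (integrable_gibbsWeight hlam J) hgm hg2

/-- **FOR EVERY FLOW, `Var(f) ≤ σ²_chain(f)` on lattice φ⁴**: `λ > 0`, real `J`, any positive
measurable flow `q̃` with `∫ q̃ = 1`, `f ∈ PolyObs` with a summable series along `imhOpPhi4 J λ q̃`:
`(∫ (f−⟨f⟩)² e^{−S})/Z ≤ 2 τ_int(f) · (∫ (f−⟨f⟩)² e^{−S})/Z` — with `phi4_sq_meanAbsDev_le_var` and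
`phi4_exists_flow_reweightMoment_le`: reweighting an observable-targeted flow can go below the
variance floor that the exact chain of no flow crosses. -/
theorem phi4Flow_targetVar_le_chainVar_poly {lam : ℝ} (hlam : 0 < lam)
    (J : Fin (n + 1) → Fin (n + 1) → ℝ) {q : (Fin (n + 1) → ℝ) → ℝ} (hq0 : ∀ φ, 0 < q φ)
    (hqm : Measurable q) (hqi : Integrable q) (hq1 : ∫ φ, q φ = 1)
    {f : (Fin (n + 1) → ℝ) → ℝ} (hf : PolyObs f)
    (hs : Summable fun k => (∫ φ, (f φ - gibbsExpect J lam f)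
        * ((imhOpPhi4 J lam q)^[k + 1] (fun ψ => f ψ - gibbsExpect J lam f)) φ * gibbsWeight J lam φ)
        / ∫ φ, (f φ - gibbsExpect J lam f) ^ 2 * gibbsWeight J lam φ) :
    (∫ φ, (f φ - gibbsExpect J lam f) ^ 2 * gibbsWeight J lam φ) / gibbsZ J lam
      ≤ 2 * tauInt (fun k => (∫ φ, (f φ - gibbsExpect J lam f)
            * ((imhOpPhi4 J lam q)^[k] (fun ψ => f ψ - gibbsExpect J lam f)) φ * gibbsWeight J lam φ)
            / ∫ φ, (f φ - gibbsExpect J lam f) ^ 2 * gibbsWeight J lam φ)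
        * ((∫ φ, (f φ - gibbsExpect J lam f) ^ 2 * gibbsWeight J lam φ) / gibbsZ J lam) := by
  obtain ⟨hgm, hg2⟩ := polyObs_sq_integrable hlam J (polyObs_sub_const hf (gibbsExpect J lam f))
  rw [imhOpPhi4_eq_imhOp] at hs ⊢
  exact imhOp_targetVar_le_chainVar_of_sq (μ := volume) (fun φ => gibbsWeight_pos J lam φ)
    (continuous_gibbsWeight J lam).measurable (integrable_gibbsWeight hlam J) hq0 hqm hqi hq1 hgm
    hg2 hs

end Lattice

end Summit.Ventures.LatticeQCDFlow.Exactness
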